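/-
Copyright (c) 2026 the pub-hodgecm-mathlib formalisation cell (harness21).  Prover seat hodgecm-mathlib-F0P3-p01 (g32), Track A «(D-RAM) FOUR-FRAME», unit U2H, census leaf
(ρ2b′-X) — T5b «toric level census, type RamK»: `J(c) = [Ũ : Ṽ_c] = (q+1)·q^{⌈c∕2⌉−1}` — Flicker's order-unit index on the UNRAMIFIED third field, read in `Mˣ`.  2026-09-04.
-/
import Literature.NumberTheory.LocalFields.QuadraticOrderTorusIndices   -- ★ (LH4-p08 (g4)): `relIndex_orderUnits_eq_of_unramified` (Flicker Prop. 7 in `Mˣ`), transport plumbing; brings ★ p857227 `exists_subgroup_v_eq_one`, `exists_subgroup_depth`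
import HarnessLib

/-!
# The `ρ`-depth index of the `Θ`-fixed units when the third field is UNRAMIFIED over the base: `[Ũ : Ṽ_c] = (q+1)·q^{⌈c∕2⌉−1}` (`c ≥ 1`)
(Flicker 1998 Prop. 7 p. 84 (the unit index of the orders `R + π^jR_E` of an unramified quadratic extension); Serre, *Local Fields* Ch. V §1)

Topic `NumberTheory/LocalFields`; namespace `Literature.NumberTheory.LocalFields.QuadraticOrder`.  THEOREMS ONLY (no definition, no instance, no notation, no named fact, no
`sorry`); kernel lane `--supports stmt-HodgeConjecture-24833` (count-neutral).  Cell `pub/hodgecm-mathlib` (D-0151), crux H413, Track A, unit U2H, census leaf (ρ2b′-X): TYPE RamK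
of the toric census (hodgecm-mathlib-F0P3-p01 (g32) T5b memo §2): the last type-specific number `J(c) := [Ũ : Ṽ_c]`, `Ũ = {Θz = z, |z| = 1}`, `Ṽ_c = Ũ ∩ {|z − ρz| ≤ exp(−c)}`
(★ p857299's letters), which ★ `QuadraticOrderNormDepthIndexTwo.relIndex_normDepth_eq_ite_of_index_two` halves above the threshold `c ≥ 2d − 1`.  DEVICE (= ★ `QuadraticOrderTorusIndices`
§2, LH4-p08 (g4)): the third field `K♮` is handed over as a valued field `K′` with an isometric-UP-TO-SQUARING embedding `jK : K′ →+* M` onto `Fix Θ` intertwining its involution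
`σ′` with `ρ` — in type RamK `M ∕ K♮` is RAMIFIED, so `|jK x|_M = |x|_{K′}²`, and `K′ ∕ F′` is UNRAMIFIED (an integer `α′` with `|α′ − σ′α′| = 1`, `#𝓀[K′] = q²`).  Then
`jK⁻¹(Ṽ_c) = {w ∈ 𝒪_{K′}ˣ : |w − σ′w| ≤ |π′|^{⌈c∕2⌉}}` = the units of the order of conductor `π′^{⌈c∕2⌉}` (`sq_le_exp_neg_iff`: `x² ≤ exp(−c) ⟺ x ≤ exp(−⌈c∕2⌉)`), and ★ Flicker
`relIndex_orderUnits_eq_of_unramified` on `K′` gives **`relIndex_thetaFixed_depth_eq_of_unramified`: `[Ũ : Ṽ_c] = (q+1)·q^{⌈c∕2⌉−1}`** (`c ≥ 1`).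
HONEST LABEL: HC_CM is proved only modulo the 7 printed citations (2 remaining named inputs: hLiu418 = stmt-HodgeConjecture-24832, h413 = stmt-HodgeConjecture-24833) until rung 0
closes; unconditional local algebra, count-neutral.

## References
* [Flicker1998UnitaryFL] Y. Z. Flicker, *Elementary proof of the fundamental lemma for a unitary group*, Canad. J. Math. 50 (1998): Prop. 7 p. 84.
* [Serre1979] J.-P. Serre, *Local Fields*, GTM 67 (1979): Ch. V §1 (units and their filtration).
-/

set_option autoImplicit false

open WithZero IsLocalRing
open scoped Valued
open Literature.NumberTheory.LocalFields.WildQuadraticDatum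

namespace Literature.NumberTheory.LocalFields.QuadraticOrder

/-! ## §0 Squaring in `ℤᵐ⁰` -/

/-- `x² = 1 ↔ x = 1` in `ℤᵐ⁰`. [folklore] -/
private theorem sq_eq_one_iff_withZero (x : ℤᵐ⁰) : x ^ 2 = 1 ↔ x = 1 := by
  refine ⟨fun h => ?_, fun h => by rw [h, one_pow]⟩
  rcases eq_or_ne x 0 with rfl | h0
  · rw [zero_pow two_ne_zero] at h; exact absurd h zero_ne_one
  · have h' := congrArg log h
    rw [log_pow, log_one, nsmul_eq_mul] at h'
    have hlog : log x = 0 := by push_cast at h'; omega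
    rw [← exp_log h0, hlog, exp_zero]

/-- **`x² ≤ exp(−c) ↔ x ≤ exp(−⌈c∕2⌉)`** in `ℤᵐ⁰` (`⌈c∕2⌉ = (c+1)∕2` in `ℕ`): the depth conversion between `M` and the third field when `|jK x| = |x|²`. [folklore] -/
private theorem sq_le_exp_neg_iff (x : ℤᵐ⁰) (c : ℕ) : x ^ 2 ≤ exp (-(c : ℤ)) ↔ x ≤ exp (-(((c + 1) / 2 : ℕ) : ℤ)) := by
  rcases eq_or_ne x 0 with rfl | h0
  · simp
  · conv_lhs => rw [← exp_log h0, ← exp_nsmul, exp_le_exp]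
    conv_rhs => rw [← exp_log h0, exp_le_exp]
    rw [nsmul_eq_mul]; push_cast; omega

/-! ## §1 `[Ũ : Ṽ_c]` along the embedding of the unramified third field -/

section ThirdField

variable {K K' : Type*} [Field K] [Valued K ℤᵐ⁰] [Field K'] [Valued K' ℤᵐ⁰] {ρ Θ : K →+* K} {σ' : K' →+* K'} {α' π' : K'}

/-- **`J(c) = [Ũ : Ṽ_c] = (q+1)·q^{⌈c∕2⌉−1}` FOR `c ≥ 1`** when the third field `K′` (involution `σ′`, UNRAMIFIED frame `|α′ − σ′α′| = 1`, uniformiser `π′`, `#𝓀[K′] = q²`) embeds by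
`jK : K′ →+* M` ONTO `Fix Θ` with `|jK x| = |x|²` and `jK ∘ σ′ = ρ ∘ jK`: the pull-back of `Ṽ_c` is the unit group of the order of conductor `π′^{⌈c∕2⌉}`, counted by ★ Flicker
`relIndex_orderUnits_eq_of_unramified`. [cite: Flicker1998UnitaryFL, Prop. 7 p. 84] [cite: Serre1979, Ch. V §1] -/
theorem relIndex_thetaFixed_depth_eq_of_unramified
    (hσ' : ∀ x, σ' (σ' x) = x) (hvσ' : ∀ x, Valued.v (σ' x) = Valued.v x) (hα'1 : Valued.v α' ≤ 1) (hα' : Valued.v (α' - σ' α') = 1)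
    (hπ' : Valued.v π' = exp (-1 : ℤ)) [IsDiscreteValuationRing 𝒪[K']] [Finite 𝓀[K']] {q : ℕ} (hq : Nat.card 𝓀[K'] = q ^ 2)
    (jK : K' →+* K) (hjv : ∀ x, Valued.v (jK x) = Valued.v x ^ 2) (hjΘ : ∀ x, Θ (jK x) = jK x) (hjfix : ∀ z : K, Θ z = z → ∃ x, jK x = z)
    (hjσ : ∀ x, jK (σ' x) = ρ (jK x)) {c : ℕ} (hc : 1 ≤ c) (Ut Vt : Subgroup Kˣ)
    (hUt : ∀ z, z ∈ Ut ↔ Θ (z : K) = z ∧ Valued.v (z : K) = 1)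
    (hVt : ∀ z, z ∈ Vt ↔ Θ (z : K) = z ∧ Valued.v (z : K) = 1 ∧ Valued.v ((z : K) - ρ z) ≤ exp (-(c : ℤ))) :
    Vt.relIndex Ut = (q + 1) * q ^ ((c + 1) / 2 - 1) := by
  obtain ⟨U', hU'⟩ := exists_subgroup_v_eq_one (K := K')
  obtain ⟨V', hV'⟩ := exists_subgroup_depth hσ' hvσ' hπ' ((c + 1) / 2)
  set f : K'ˣ →* Kˣ := Units.map (jK : K' →* K) with hf
  have hfval : ∀ w : K'ˣ, ((f w : Kˣ) : K) = jK w := fun w => by rw [hf, Units.coe_map, MonoidHom.coe_coe]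
  have hinj : Function.Injective f := by
    intro a b hab
    have := congrArg (fun u : Kˣ => (u : K)) hab
    simp only [hfval] at this
    exact Units.ext (jK.injective this)
  -- a `Θ`-fixed unit of `M` is the image of a unit of `K′`
  have hlift : ∀ z : Kˣ, Θ (z : K) = z → ∃ w : K'ˣ, f w = z := by
    intro z hz
    obtain ⟨x, hx⟩ := hjfix z hz
    have hx0 : x ≠ 0 := fun h0 => by rw [h0, map_zero] at hx; exact z.ne_zero hx.symm
    exact ⟨Units.mk0 x hx0, Units.ext (by rw [hfval, Units.val_mk0, hx])⟩
  have hunit : ∀ w : K'ˣ, Valued.v ((f w : Kˣ) : K) = 1 ↔ Valued.v (w : K') = 1 := fun w => by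
    rw [hfval, hjv, sq_eq_one_iff_withZero]
  have hdepth : ∀ w : K'ˣ, Valued.v (((f w : Kˣ) : K) - ρ ((f w : Kˣ) : K)) ≤ exp (-(c : ℤ)) ↔
      Valued.v (σ' (w : K') - w) ≤ Valued.v (π' ^ ((c + 1) / 2)) := fun w => by
    rw [hfval, ← hjσ, ← map_sub, hjv, sq_le_exp_neg_iff, Valuation.map_sub_swap, map_pow, hπ', ← exp_nsmul, smul_neg, nsmul_eq_mul, mul_one]
  have hUt' : Ut = U'.map f := by
    ext z
    rw [hUt, Subgroup.mem_map]
    constructor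
    · rintro ⟨hz, hz1⟩
      obtain ⟨w, rfl⟩ := hlift z hz
      exact ⟨w, (hU' w).2 ((hunit w).1 hz1), rfl⟩
    · rintro ⟨w, hw, rfl⟩
      exact ⟨by rw [hfval, hjΘ], (hunit w).2 ((hU' w).1 hw)⟩
  have hVt' : Vt = V'.map f := by
    ext z
    rw [hVt, Subgroup.mem_map]
    constructor
    · rintro ⟨hz, hz1, hzd⟩
      obtain ⟨w, rfl⟩ := hlift z hz
      exact ⟨w, (hV' w).2 ⟨(hunit w).1 hz1, (hdepth w).1 hzd⟩, rfl⟩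
    · rintro ⟨w, hw, rfl⟩
      obtain ⟨hw1, hwd⟩ := (hV' w).1 hw
      exact ⟨by rw [hfval, hjΘ], (hunit w).2 hw1, (hdepth w).2 hwd⟩
  rw [hUt', hVt', Subgroup.relIndex_map_map_of_injective _ _ hinj]
  exact relIndex_orderUnits_eq_of_unramified hσ' hvσ' hα'1 hα' hπ' hq (j := (c + 1) / 2) (by omega) U' V' hU'
    (fun u => by rw [hV', Valuation.map_sub_swap])

end ThirdField

end Literature.NumberTheory.LocalFields.QuadraticOrder
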